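import Mathlib
import HarnessLib
import Summits.NavierStokesRegularity.NavierStokesRegularity.Theorems.HalfSpaceWindowDoorCirculationCarryingRigidityGaussExtremalMoments
import Summits.NavierStokesRegularity.NavierStokesRegularity.Theorems.HalfSpaceWindowDoorCirculationCarryingRigidityGaussSwirlLaw
import Literature.Analysis.FluidPDE.Wei2016FarFieldPointwise

/-!
# Route `HalfSpaceWindowDoor`, crux `CirculationCarryingRigidity` (stmt-NavierStokesRegularity-25311) —
# the GAUSSIAN TILTING MOMENT is pinned at the extremal point: `|𝒯 − 2∫G₁ω₃| ≤ √6·C·∫G₁ω₃`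

LEAD ns-hsw-p1 g7 (cell pub-ns-dss), `--supports stmt-NavierStokesRegularity-25311 --as helper`; sequel of `…GaussExtremalMoments`.  Read the
maximal-inflow identity (E3) `ℐ(1;0)[W(−1)] = −2·(4π)^{3/2}·2·∫G₁ω₃` through the kinematic swirl–inflow identity O1b
(`gaussianInflowIdentity_holds`: `ℐ(1;0)[u] = (4π)^{3/2}·2·∫G₁[(x_h·u_h)ω₃ − (x_h·ω_h)u₃]`): with the Gaussian RADIAL-INFLOW moment
`𝒜 := ∫G₁ (x_h·u_h) ω₃` and the Gaussian TILTING moment `𝒯 := ∫G₁ (x_h·ω_h) u₃` of the extremal slice `u = W(−1)`,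
`𝒜 − 𝒯 = −2∫G₁ω₃`.  The closed-hemisphere sign, the Type-I bound `‖u‖ ≤ C` at `τ = −1`, AM–GM `‖x‖ ≤ ‖x‖²/(2√6) + √6/2` and the upper
moment bound `∫‖x‖²G₁ω₃ ≤ 6∫G₁ω₃` of `gaussExtremal_moments` give `|𝒜| ≤ √6·C·∫G₁ω₃`, hence

* `gaussExtremal_tilting` — **`(2 − √6 C)·∫G₁ω₃ ≤ 𝒯 ≤ (2 + √6 C)·∫G₁ω₃`** at the Gaussian-extremal point of (some extremal profile of) every
  enemy of W6 with constant `C`.  For `C < 2/√6` the tilting moment is POSITIVE: in Gaussian mean about the extremal axis the horizontal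
  vorticity points OUTWARD where the fluid rises and INWARD where it sinks — the enemy converts horizontal into vertical vorticity by a tilting
  moment `≈ 2Θ`, and radial inflow alone (`𝒜`) cannot pay the bill (E3) unless `C ≥ 2/√6`.
* `hemisphereLiouvilleE3_of_tilting` — the corresponding reduction.

WHAT THIS IS NOT: not a statement about Navier–Stokes regularity; door statements concern HYPOTHETICAL blow-up profiles.  No item is
closed by this file.
-/

noncomputable section

-- the summit and its single sub-problem share the name (CONVENTIONS §1), as in every Theorems file
set_option linter.dupNamespace false

namespace Summit.NavierStokesRegularity.NavierStokesRegularity.Theorems.HalfSpaceWindowDoorCirculationCarryingRigidityGaussExtremalTilting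

open MeasureTheory Set Function Filter Topology
open scoped RealInnerProductSpace InnerProductSpace
open Literature.Analysis Literature.Analysis.FluidPDE Literature.Analysis.UnboundedOperators
open Summit.NavierStokesRegularity.NavierStokesRegularity.Theses.HalfSpaceWindowDoor
open Summit.NavierStokesRegularity.NavierStokesRegularity.Theorems.HalfSpaceWindowDoorCirculationCarryingRigidityDefs
open Summit.NavierStokesRegularity.NavierStokesRegularity.Theorems.HalfSpaceWindowDoorCirculationCarryingRigidityReduction
  (circulationCarryingRigidity_of_hemisphereLiouvilleE3)
open Summit.NavierStokesRegularity.NavierStokesRegularity.Theorems.HalfSpaceWindowDoorCirculationCarryingRigidityGaussKernel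
  (inner_e3_apply)
open Summit.NavierStokesRegularity.NavierStokesRegularity.Theorems.HalfSpaceWindowDoorCirculationCarryingRigidityGaussSwirlLaw
  (gaussianInflowIdentity_holds)
open Summit.NavierStokesRegularity.NavierStokesRegularity.Theorems.HalfSpaceWindowDoorCirculationCarryingRigidityGaussExtremalConditions
  (omega3_continuous_bounded)
open Summit.NavierStokesRegularity.NavierStokesRegularity.Theorems.HalfSpaceWindowDoorCirculationCarryingRigidityGaussExtremalMoments
  (gaussExtremal_moments)
open Summit.NavierStokesRegularity.NavierStokesRegularity.Theorems.LocalSineTubeDoorProfileAlignedWindowRigidityAncient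
  (bdd_of_hasTypeITimeDecay analyticOnNhd_slice)
open Summit.NavierStokesRegularity.NavierStokesRegularity.Theorems.PoloidalWindowDoorPoloidalWindowRigidityClassSpaceTimeRates
  (exists_fderiv_rate_of_class')

variable {C : ℝ}

/-- AM–GM in the form used: `r ≤ (√6/12) r² + √6/2` for every real `r` (equality at `r = √6`). -/
theorem le_sqrt6_sq_add (r : ℝ) : r ≤ Real.sqrt 6 / 12 * r ^ 2 + Real.sqrt 6 / 2 := by
  have h6 : 0 ≤ Real.sqrt 6 := Real.sqrt_nonneg 6
  have hsq : Real.sqrt 6 * Real.sqrt 6 = 6 := Real.mul_self_sqrt (by norm_num)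
  have key : Real.sqrt 6 * (r - Real.sqrt 6) ^ 2 = Real.sqrt 6 * r ^ 2 - 12 * r + 6 * Real.sqrt 6 := by
    have e : Real.sqrt 6 * (r - Real.sqrt 6) ^ 2 =
        Real.sqrt 6 * r ^ 2 - 2 * (Real.sqrt 6 * Real.sqrt 6) * r + (Real.sqrt 6 * Real.sqrt 6) * Real.sqrt 6 := by ring
    rw [e, hsq]; ring
  have hnn : 0 ≤ Real.sqrt 6 * (r - Real.sqrt 6) ^ 2 := mul_nonneg h6 (sq_nonneg _)
  rw [key] at hnn
  linarith

/-- Cauchy–Schwarz for the horizontal pairing: `|y₀u₀ + y₁u₁| ≤ ‖y‖·C` whenever `‖u‖ ≤ C`. -/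
theorem abs_horiz_dot_le (y u : EuclideanSpace ℝ (Fin 3)) {C : ℝ} (hu : ‖u‖ ≤ C) :
    |y 0 * u 0 + y 1 * u 1| ≤ ‖y‖ * C := by
  have hC : 0 ≤ C := (norm_nonneg _).trans hu
  have hlag : (y 0 * u 0 + y 1 * u 1) ^ 2 ≤ (y 0 ^ 2 + y 1 ^ 2) * (u 0 ^ 2 + u 1 ^ 2) := by
    nlinarith [sq_nonneg (y 0 * u 1 - y 1 * u 0)]
  have hy := Literature.Analysis.FluidPDE.Wei2016.sq_add_sq_le_norm_sq y
  have huu : u 0 ^ 2 + u 1 ^ 2 ≤ C ^ 2 := (Literature.Analysis.FluidPDE.Wei2016.sq_add_sq_le_norm_sq u).trans (pow_le_pow_left₀ (norm_nonneg _) hu 2)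
  have hle : (y 0 * u 0 + y 1 * u 1) ^ 2 ≤ (‖y‖ * C) ^ 2 := by
    rw [mul_pow]
    exact hlag.trans (mul_le_mul hy huu (by positivity) (sq_nonneg _))
  exact abs_le_of_sq_le_sq hle (by positivity)

/-- Crude bound for the horizontal pairing with component bounds: `|y₀w₀ + y₁w₁| ≤ 2K‖y‖` whenever `|wᵢ| ≤ K`. -/
theorem abs_horiz_dot_le_two (y w : EuclideanSpace ℝ (Fin 3)) {K : ℝ} (hw : ∀ i : Fin 3, |w i| ≤ K) :
    |y 0 * w 0 + y 1 * w 1| ≤ 2 * K * ‖y‖ := by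
  have hc : ∀ i : Fin 3, |y i| ≤ ‖y‖ := fun i => by rw [← Real.norm_eq_abs]; exact PiLp.norm_apply_le y i
  calc |y 0 * w 0 + y 1 * w 1| ≤ |y 0 * w 0| + |y 1 * w 1| := abs_add_le _ _
    _ = |y 0| * |w 0| + |y 1| * |w 1| := by rw [abs_mul, abs_mul]
    _ ≤ ‖y‖ * K + ‖y‖ * K :=
        add_le_add (mul_le_mul (hc 0) (hw 0) (abs_nonneg _) (norm_nonneg _)) (mul_le_mul (hc 1) (hw 1) (abs_nonneg _) (norm_nonneg _))
    _ = 2 * K * ‖y‖ := by ring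

/-- A continuous slice of a door-class profile: components of `v(s)` and of `curl v(s)` are continuous and bounded. -/
theorem slice_components {v : ℝ → EuclideanSpace ℝ (Fin 3) → EuclideanSpace ℝ (Fin 3)} (hv : InDoorClass C v)
    {s : ℝ} (hs : s < 0) :
    (∀ i : Fin 3, Continuous fun x => v s x i) ∧ (∀ (i : Fin 3) x, |v s x i| ≤ C / Real.sqrt (-s)) ∧
    (∀ i : Fin 3, Continuous fun x => curl (v s) x i) ∧ ∃ K : ℝ, ∀ (i : Fin 3) x, |curl (v s) x i| ≤ K := by
  obtain ⟨hrate, hcont, hmild, -⟩ := hv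
  obtain ⟨K₁, -, hK₁⟩ := exists_fderiv_rate_of_class' hrate hcont hmild
  have hA : AnalyticOnNhd ℝ (v s) univ := analyticOnNhd_slice hcont (bdd_of_hasTypeITimeDecay hrate) hmild hs
  have hVc : Continuous (v s) := continuousOn_univ.1 hA.continuousOn
  have hDc : Continuous (fderiv ℝ (v s)) := continuousOn_univ.1 hA.fderiv.continuousOn
  have hcurlc : Continuous (curl (v s)) := by
    rw [curl_eq_curlCLM_comp]; exact curlCLM.continuous.comp hDc
  have happly : ∀ (w : EuclideanSpace ℝ (Fin 3)) (i : Fin 3), |w i| ≤ ‖w‖ := fun w i => by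
    rw [← Real.norm_eq_abs]; exact PiLp.norm_apply_le w i
  refine ⟨fun i => (continuous_apply i).comp ((PiLp.continuous_ofLp 2 _).comp hVc),
    fun i x => (happly _ i).trans (hrate s hs x),
    fun i => (continuous_apply i).comp ((PiLp.continuous_ofLp 2 _).comp hcurlc), 4 * (K₁ / (-s)), fun i x => ?_⟩
  calc |curl (v s) x i| ≤ ‖curl (v s) x‖ := happly _ i
    _ ≤ 4 * ‖fderiv ℝ (v s) x‖ := norm_curl_le_four_mul _ _
    _ ≤ 4 * (K₁ / (-s)) := by gcongr; exact hK₁ s hs x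

/-- **THE TILTING MOMENT IS PINNED at the Gaussian-extremal point.**  If some closed-hemisphere door-class profile (Type-I constant `C`)
has `⟪curl v(s₁)(y₁), e₃⟫ > 0` somewhere, there is a closed-hemisphere door-class `W` (constant `C`) whose slice `u = W(−1)`, `ω = curl u`,
has `0 < ∫G₁ω₃` and
`(2 − √6 C)·∫G₁ω₃ ≤ ∫ G₁(x)·(x₀ω₀ + x₁ω₁)·u₃ dx ≤ (2 + √6 C)·∫G₁ω₃` (`G₁ = heatKernel 1`; coordinates `0, 1` horizontal, `2` vertical). -/
theorem gaussExtremal_tilting {v : ℝ → EuclideanSpace ℝ (Fin 3) → EuclideanSpace ℝ (Fin 3)} (hv : InDoorClass C v)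
    (hsign : SignE3 v) (hpos : ∃ s < 0, ∃ y, 0 < ⟪curl (v s) y, e3⟫) :
    ∃ W : ℝ → EuclideanSpace ℝ (Fin 3) → EuclideanSpace ℝ (Fin 3), InDoorClass C W ∧ SignE3 W ∧
      0 < ∫ y, heatKernel 1 y * curl (W (-1)) y 2 ∧
      (2 - Real.sqrt 6 * C) * ∫ y, heatKernel 1 y * curl (W (-1)) y 2 ≤
        ∫ y, heatKernel 1 y * ((y 0 * curl (W (-1)) y 0 + y 1 * curl (W (-1)) y 1) * W (-1) y 2) ∧
      ∫ y, heatKernel 1 y * ((y 0 * curl (W (-1)) y 0 + y 1 * curl (W (-1)) y 1) * W (-1) y 2) ≤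
        (2 + Real.sqrt 6 * C) * ∫ y, heatKernel 1 y * curl (W (-1)) y 2 := by
  obtain ⟨W, hW, hWs, h0, -, h2, hI⟩ := gaussExtremal_moments hv hsign hpos
  have hm1 : (-1 : ℝ) < 0 := by norm_num
  -- rewrite `⟪curl, e₃⟫` as the component `2`
  have hcomp : (fun y : EuclideanSpace ℝ (Fin 3) => heatKernel 1 y * ⟪curl (W (-1)) y, e3⟫) =
      fun y => heatKernel 1 y * curl (W (-1)) y 2 := by funext y; rw [inner_e3_apply]
  have hcomp2 : (fun y : EuclideanSpace ℝ (Fin 3) => ‖y‖ ^ 2 * heatKernel 1 y * ⟪curl (W (-1)) y, e3⟫) =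
      fun y => ‖y‖ ^ 2 * heatKernel 1 y * curl (W (-1)) y 2 := by funext y; rw [inner_e3_apply]
  rw [hcomp] at h0 h2 hI
  rw [hcomp2] at h2
  set M₀ : ℝ := ∫ y, heatKernel 1 y * curl (W (-1)) y 2 with hM₀
  set M₂ : ℝ := ∫ y, ‖y‖ ^ 2 * heatKernel 1 y * curl (W (-1)) y 2 with hM₂
  -- slice data
  obtain ⟨hvc, -, hωc, K, hωK⟩ := slice_components hW hm1
  have hvC : ∀ x, ‖W (-1) x‖ ≤ C := fun x => by
    have h := hW.1 (-1) hm1 x; rwa [neg_neg, Real.sqrt_one, div_one] at h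
  have hC0 : 0 ≤ C := (norm_nonneg _).trans (hvC 0)
  have hK0 : 0 ≤ K := (abs_nonneg _).trans (hωK 0 0)
  have hv2 : ∀ x, |W (-1) x 2| ≤ C := fun x =>
    ((Real.norm_eq_abs _).symm.le.trans (PiLp.norm_apply_le (W (-1) x) 2)).trans (hvC x)
  have hω3nn : ∀ x, 0 ≤ curl (W (-1)) x 2 := fun x => by rw [← inner_e3_apply]; exact hWs (-1) hm1 x
  -- O1b at `(t, x₀, s) = (1, 0, -1)`
  have hO1b := gaussianInflowIdentity_holds C W hW 0 1 (-1) one_pos hm1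
  simp only [sub_zero, mul_one] at hO1b
  -- the two moments `𝒜` (radial inflow) and `𝒯` (tilting)
  set A : ℝ := ∫ y, heatKernel 1 y * ((y 0 * W (-1) y 0 + y 1 * W (-1) y 1) * curl (W (-1)) y 2) with hA
  set T : ℝ := ∫ y, heatKernel 1 y * ((y 0 * curl (W (-1)) y 0 + y 1 * curl (W (-1)) y 1) * W (-1) y 2) with hT
  -- integrability of the pieces: bounded continuous × first Gaussian moment
  have hmom1 : Integrable (fun y : EuclideanSpace ℝ (Fin 3) => heatKernel 1 y * ‖y‖) :=
    integrable_heatKernel_mul_norm (E := EuclideanSpace ℝ (Fin 3)) one_pos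
  have hcont_yi : ∀ i : Fin 3, Continuous fun y : EuclideanSpace ℝ (Fin 3) => y i := fun i =>
    (continuous_apply i).comp (PiLp.continuous_ofLp 2 _)
  have hG1c : Continuous fun y : EuclideanSpace ℝ (Fin 3) => heatKernel 1 y := by
    unfold heatKernel; fun_prop
  have hintA : Integrable (fun y : EuclideanSpace ℝ (Fin 3) =>
      heatKernel 1 y * ((y 0 * W (-1) y 0 + y 1 * W (-1) y 1) * curl (W (-1)) y 2)) := by
    refine Integrable.mono' (hmom1.const_mul (C * K)) ?_ (ae_of_all _ fun y => ?_)
    · exact (hG1c.mul ((((hcont_yi 0).mul (hvc 0)).add ((hcont_yi 1).mul (hvc 1))).mul (hωc 2))).aestronglyMeasurable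
    · have hG : 0 ≤ heatKernel 1 y := (heatKernel_pos one_pos _).le
      rw [Real.norm_eq_abs, abs_mul, abs_of_nonneg hG, abs_mul]
      calc heatKernel 1 y * (|y 0 * W (-1) y 0 + y 1 * W (-1) y 1| * |curl (W (-1)) y 2|)
          ≤ heatKernel 1 y * ((‖y‖ * C) * K) :=
            mul_le_mul_of_nonneg_left (mul_le_mul (abs_horiz_dot_le y (W (-1) y) (hvC y)) (hωK 2 y) (abs_nonneg _)
              (by positivity)) hG
        _ = C * K * (heatKernel 1 y * ‖y‖) := by ring
  have hintT : Integrable (fun y : EuclideanSpace ℝ (Fin 3) =>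
      heatKernel 1 y * ((y 0 * curl (W (-1)) y 0 + y 1 * curl (W (-1)) y 1) * W (-1) y 2)) := by
    refine Integrable.mono' (hmom1.const_mul (2 * K * C)) ?_ (ae_of_all _ fun y => ?_)
    · exact (hG1c.mul ((((hcont_yi 0).mul (hωc 0)).add ((hcont_yi 1).mul (hωc 1))).mul (hvc 2))).aestronglyMeasurable
    · have hG : 0 ≤ heatKernel 1 y := (heatKernel_pos one_pos _).le
      rw [Real.norm_eq_abs, abs_mul, abs_of_nonneg hG, abs_mul]
      calc heatKernel 1 y * (|y 0 * curl (W (-1)) y 0 + y 1 * curl (W (-1)) y 1| * |W (-1) y 2|)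
          ≤ heatKernel 1 y * ((2 * K * ‖y‖) * C) :=
            mul_le_mul_of_nonneg_left (mul_le_mul (abs_horiz_dot_le_two y (curl (W (-1)) y) (fun i => hωK i y)) (hv2 y)
              (abs_nonneg _) (by positivity)) hG
        _ = 2 * K * C * (heatKernel 1 y * ‖y‖) := by ring
  -- O1b integral = `𝒜 − 𝒯`
  have hsplit : ∫ x : EuclideanSpace ℝ (Fin 3), heatKernel 1 x *
      (x 0 * (W (-1) x 0 * curl (W (-1)) x 2 - curl (W (-1)) x 0 * W (-1) x 2) +
        x 1 * (W (-1) x 1 * curl (W (-1)) x 2 - curl (W (-1)) x 1 * W (-1) x 2)) = A - T := by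
    rw [hA, hT, ← integral_sub hintA hintT]
    congr 1; funext x; ring
  rw [hsplit] at hO1b
  -- (E3) ⇒ `𝒜 − 𝒯 = −2 M₀`
  have hc : 0 < (4 * Real.pi) ^ ((3 : ℝ) / 2) * 2 := by positivity
  have hAT : A - T = -2 * M₀ := by
    have h' : (4 * Real.pi) ^ ((3 : ℝ) / 2) * 2 * (A - T) = (4 * Real.pi) ^ ((3 : ℝ) / 2) * 2 * (-2 * M₀) := by
      rw [← hO1b, hI]; ring
    exact mul_left_cancel₀ hc.ne' h'
  -- `|𝒜| ≤ √6 C M₀` by Cauchy–Schwarz, AM–GM and the moment bound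
  have hint0 : Integrable (fun y : EuclideanSpace ℝ (Fin 3) => heatKernel 1 y * curl (W (-1)) y 2) := by
    obtain ⟨hωc', B, hωB'⟩ := omega3_continuous_bounded hW hm1
    have h := ((integrable_heatKernel_holds (E := EuclideanSpace ℝ (Fin 3)) one_pos).bdd_mul hωc'.aestronglyMeasurable
      (ae_of_all _ fun x => hωB' x))
    refine h.congr (ae_of_all _ fun x => ?_)
    show ⟪curl (W (-1)) x, e3⟫ * heatKernel 1 x = heatKernel 1 x * curl (W (-1)) x 2
    rw [inner_e3_apply, mul_comm]
  have hint2 : Integrable (fun y : EuclideanSpace ℝ (Fin 3) => ‖y‖ ^ 2 * heatKernel 1 y * curl (W (-1)) y 2) := by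
    obtain ⟨hωc', B, hωB'⟩ := omega3_continuous_bounded hW hm1
    have h := ((integrable_norm_sq_mul_heatKernel (E := EuclideanSpace ℝ (Fin 3)) one_pos).bdd_mul hωc'.aestronglyMeasurable
      (ae_of_all _ fun x => hωB' x))
    refine h.congr (ae_of_all _ fun x => ?_)
    show ⟪curl (W (-1)) x, e3⟫ * (‖x‖ ^ 2 * heatKernel 1 x) = ‖x‖ ^ 2 * heatKernel 1 x * curl (W (-1)) x 2
    rw [inner_e3_apply]; ring
  have hAbs : |A| ≤ Real.sqrt 6 * C * M₀ := by
    have hdom : ∀ y : EuclideanSpace ℝ (Fin 3), ‖heatKernel 1 y * ((y 0 * W (-1) y 0 + y 1 * W (-1) y 1) * curl (W (-1)) y 2)‖ ≤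
        C * ((Real.sqrt 6 / 12) * (‖y‖ ^ 2 * heatKernel 1 y * curl (W (-1)) y 2) +
          (Real.sqrt 6 / 2) * (heatKernel 1 y * curl (W (-1)) y 2)) := by
      intro y
      have hG : 0 ≤ heatKernel 1 y := (heatKernel_pos one_pos _).le
      have hω := hω3nn y
      have h1 : |y 0 * W (-1) y 0 + y 1 * W (-1) y 1| ≤ ‖y‖ * C := abs_horiz_dot_le y (W (-1) y) (hvC y)
      have hamgm := le_sqrt6_sq_add ‖y‖
      rw [Real.norm_eq_abs, abs_mul, abs_of_nonneg hG, abs_mul, abs_of_nonneg hω]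
      calc heatKernel 1 y * (|y 0 * W (-1) y 0 + y 1 * W (-1) y 1| * curl (W (-1)) y 2)
          ≤ heatKernel 1 y * ((‖y‖ * C) * curl (W (-1)) y 2) :=
            mul_le_mul_of_nonneg_left (mul_le_mul_of_nonneg_right h1 hω) hG
        _ = C * (‖y‖ * (heatKernel 1 y * curl (W (-1)) y 2)) := by ring
        _ ≤ C * ((Real.sqrt 6 / 12 * ‖y‖ ^ 2 + Real.sqrt 6 / 2) * (heatKernel 1 y * curl (W (-1)) y 2)) :=
            mul_le_mul_of_nonneg_left (mul_le_mul_of_nonneg_right hamgm (mul_nonneg hG hω)) hC0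
        _ = C * ((Real.sqrt 6 / 12) * (‖y‖ ^ 2 * heatKernel 1 y * curl (W (-1)) y 2) +
              (Real.sqrt 6 / 2) * (heatKernel 1 y * curl (W (-1)) y 2)) := by ring
    have hintB : Integrable (fun y : EuclideanSpace ℝ (Fin 3) =>
        C * ((Real.sqrt 6 / 12) * (‖y‖ ^ 2 * heatKernel 1 y * curl (W (-1)) y 2) +
          (Real.sqrt 6 / 2) * (heatKernel 1 y * curl (W (-1)) y 2))) :=
      ((hint2.const_mul _).add (hint0.const_mul _)).const_mul C
    have hnorm := norm_integral_le_of_norm_le hintB (Eventually.of_forall hdom)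
    rw [Real.norm_eq_abs] at hnorm
    have hval : ∫ y : EuclideanSpace ℝ (Fin 3), C * ((Real.sqrt 6 / 12) * (‖y‖ ^ 2 * heatKernel 1 y * curl (W (-1)) y 2) +
          (Real.sqrt 6 / 2) * (heatKernel 1 y * curl (W (-1)) y 2)) =
        C * ((Real.sqrt 6 / 12) * M₂ + (Real.sqrt 6 / 2) * M₀) := by
      rw [integral_const_mul, integral_add (hint2.const_mul _) (hint0.const_mul _), integral_const_mul, integral_const_mul]
    rw [hval] at hnorm
    have h6 : 0 ≤ Real.sqrt 6 := Real.sqrt_nonneg 6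
    have hM2 : Real.sqrt 6 / 12 * M₂ ≤ Real.sqrt 6 / 12 * (6 * M₀) := mul_le_mul_of_nonneg_left h2 (by positivity)
    calc |A| ≤ C * ((Real.sqrt 6 / 12) * M₂ + (Real.sqrt 6 / 2) * M₀) := hnorm
      _ ≤ C * ((Real.sqrt 6 / 12) * (6 * M₀) + (Real.sqrt 6 / 2) * M₀) := by gcongr
      _ = Real.sqrt 6 * C * M₀ := by ring
  -- conclude
  have hT_eq : T = A + 2 * M₀ := by linarith
  obtain ⟨hAlo, hAhi⟩ := abs_le.1 hAbs
  have hlo : (2 - Real.sqrt 6 * C) * M₀ ≤ T := by rw [hT_eq]; nlinarith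
  have hhi : T ≤ (2 + Real.sqrt 6 * C) * M₀ := by rw [hT_eq]; nlinarith
  exact ⟨W, hW, hWs, h0, hlo, hhi⟩

/-- **REDUCTION: W6 from the pinned tilting moment.**  If no closed-hemisphere door-class profile has, at `(1, −1, 0)`, positive Gaussian
vertical vorticity and a Gaussian tilting moment in the window `[(2 − √6C)∫G₁ω₃, (2 + √6C)∫G₁ω₃]`, then `HemisphereLiouvilleE3` holds. -/
theorem hemisphereLiouvilleE3_of_tilting
    (h : ∀ (C : ℝ) (W : ℝ → EuclideanSpace ℝ (Fin 3) → EuclideanSpace ℝ (Fin 3)), InDoorClass C W → SignE3 W →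
      0 < ∫ y, heatKernel 1 y * curl (W (-1)) y 2 →
      (2 - Real.sqrt 6 * C) * ∫ y, heatKernel 1 y * curl (W (-1)) y 2 ≤
        ∫ y, heatKernel 1 y * ((y 0 * curl (W (-1)) y 0 + y 1 * curl (W (-1)) y 1) * W (-1) y 2) →
      ∫ y, heatKernel 1 y * ((y 0 * curl (W (-1)) y 0 + y 1 * curl (W (-1)) y 1) * W (-1) y 2) ≤
        (2 + Real.sqrt 6 * C) * ∫ y, heatKernel 1 y * curl (W (-1)) y 2 → False) :
    HemisphereLiouvilleE3 := by
  intro C v hrate hcont hmild hdiv hsign s hs y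
  by_contra hne
  have hpos : 0 < ⟪curl (v s) y, e3⟫ := lt_of_le_of_ne (hsign s hs y) (Ne.symm hne)
  obtain ⟨W, hW, hWs, h0, h1, h2⟩ := gaussExtremal_tilting (C := C) ⟨hrate, hcont, hmild, hdiv⟩ hsign ⟨s, hs, y, hpos⟩
  exact h C W hW hWs h0 h1 h2

/-- **The crux from the pinned tilting moment** (composition with the landed plumbing `stub_rotate`). -/
theorem circulationCarryingRigidity_of_tilting
    (h : ∀ (C : ℝ) (W : ℝ → EuclideanSpace ℝ (Fin 3) → EuclideanSpace ℝ (Fin 3)), InDoorClass C W → SignE3 W →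
      0 < ∫ y, heatKernel 1 y * curl (W (-1)) y 2 →
      (2 - Real.sqrt 6 * C) * ∫ y, heatKernel 1 y * curl (W (-1)) y 2 ≤
        ∫ y, heatKernel 1 y * ((y 0 * curl (W (-1)) y 0 + y 1 * curl (W (-1)) y 1) * W (-1) y 2) →
      ∫ y, heatKernel 1 y * ((y 0 * curl (W (-1)) y 0 + y 1 * curl (W (-1)) y 1) * W (-1) y 2) ≤
        (2 + Real.sqrt 6 * C) * ∫ y, heatKernel 1 y * curl (W (-1)) y 2 → False) :
    CirculationCarryingRigidity :=
  circulationCarryingRigidity_of_hemisphereLiouvilleE3 (hemisphereLiouvilleE3_of_tilting h)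

end Summit.NavierStokesRegularity.NavierStokesRegularity.Theorems.HalfSpaceWindowDoorCirculationCarryingRigidityGaussExtremalTilting

end
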